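import Summits.QuantumFields.YangMills.Theorems.BalabanUVNodesN15KingModelPotentialDressedLimit

/-!
# BalabanUVNodes ∕ N15 — THE KING MODEL, PART 12: THE FULLY DRESSED TOWER, ITS COVARIANCES AND THEIR CONTINUUM LIMITS DEPEND
# LIPSCHITZ-CONTINUOUSLY ON THE POTENTIAL, WITH LOCALITY — `|Δ^{(j)}_v − Δ^{(j)}_{v′}|(z,w) ≤ c·sup|v − v′|·e^{−2κ′|z−w|}`,
# `|C^{(j)}_v − C^{(j)}_{v′}|(x,y) ≤ Λ·sup|v − v′|·e^{−(κ′∕2)|x−y|}` at EVERY level, and the same for ANY entrywise `k → ∞` limits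
# (Track A, DAG node N15 = NE2; FAN-OUT v1.1 §N15 s3 «KING-MODEL RUNG»)

HONEST FRAMING.  Count-neutral kernel bookkeeping (cell `pub-ymgap`, seat `pub-ymgap-dag-n15-d` g8; `--supports stmt-QuantumFields-20292
--as helper` = K3⁗ `SpineGivenEndpointR13Sep`; lineage K3 19676 → K3′ 19908 → K3‴ 19912).  THEOREMS ONLY (0 `def`, 0 `sorry`), standard axioms.
King's `A = 0` SCALAR tower on any unit torus `Π ℤ∕(LM_μ)` (§1–§3; the packaged §4 on the King-admissible tori) dressed NONPERTURBATIVELY by scalar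
potential towers `v, v′` in the uniform window `sup|v_N| ≤ w₁ ≤ w̄` (`kingTowerPot`, `fullPert`, part 9c); the potential is NOT a gauge field; nothing
here is Bałaban's `Δ^{(k)}(U)` ∕ `C^{(k)}(Λ; U)` (whose analytic dependence on `U` is [B9] Thm 3.4, printed, not an η-statement); NOT a node discharge;
nothing continuum ∕ ℝ⁴ ∕ OS ∕ mass-gap ∕ Clay.
THE POINT.  Parts 9b∕9c proved Lipschitz dependence on the potential AT ZERO (`Δ_v − Δ`, `C_v − C_0`); parts 10e∕11 built the `k → ∞` limits of the fully
dressed objects.  THIS FILE gives the two-potential Lipschitz bounds with locality, uniform in the level, and passes them to the limit: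
* §1 ★ **`kingTowerPot_lipschitz`** — `UniformKernelDecay (fullPert v − fullPert v′) tdistT (a²ctCK²K_W·δ_v) κ′` for `sup_{N,x}|v_N(x) − v′_N(x)| ≤ δ_v`
  (9b's `effLaplacianPot_lipschitz` uniformised along the run by 9c's `gap_unif`);
* §2 ★★ **`kingCovPot_lipschitz2`** — `∃ w̄, Λ > 0`: for towers of size `≤ w₁ ≤ w̄` with `δ_v ≤ 2w₁`, at EVERY level `j` and all sites,
  `|(Δ^{(j)}_v + aL⁻²Q*Q)⁻¹(x,y) − (Δ^{(j)}_{v′} + aL⁻²Q*Q)⁻¹(x,y)| ≤ Λ·δ_v·e^{−(κ′∕2)|x−y|}` — part 6a's `inv_sub_inv_perturbed_le` (King's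
  (4.39)–(4.41) at one level) on the BASE tower `Δ + E(v′)` (its H1∕H2∕H4 by 6a's `uniformCoercive_add_of_decay` ∕ `uniformCTBound_add` from
  9c's locality letter — NO coherence needed) and the perturbation `E(v) − E(v′)` of §1; the gap survives because `6·c_L·V·w₁ ≤ γ₀∕4`;
* §3 ★★ **`dressedTowerLim_lipschitz`** ∕ ★★ **`dressedCovLim_lipschitz`** — ANY entrywise limits `D_v^{(∞)}, D_{v′}^{(∞)}` (resp. `C_v^{(∞)},
  C_{v′}^{(∞)}`) of the dressed towers (resp. covariances) inherit the bounds (`le_of_tendsto`; the limits of part 10e's `king_continuumLimit_W` are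
  instances, and by uniqueness of limits the statement does not depend on how they were produced).
HONEST SCOPE.  Size window only (no coherence) for §1–§3; decay rates `2κ′` (operators) and `κ′∕2` (covariances) as in parts 9c∕6a; scalar
potential, `A = 0`; not Bałaban's Thm 3.4; not a discharge.
Locators: [King1986] C. King, CMP **102** (1986) 649–677: (2.13)–(2.15) p. 653, (4.32)–(4.34), (4.39) p. 674, (4.40)–(4.41) p. 675, pp. 675–676
(§4, A = 0 template); [B9] = [Balaban1985BackgroundPropagators] CMP **99** (1985) Thm 3.4 p. 400 (analyticity in the background: the printed
statement our Lipschitz bounds shadow), (3.35) p. 396; [Dimock2013] App. D Lemmas 29–30 (block Combes–Thomas, via part 9a).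
-/

noncomputable section

open scoped BigOperators
open Finset Filter Topology

namespace Summit.QuantumFields.YangMills.BalabanUVNodes.N15.KingModel

open Literature.MathematicalPhysics.QuantumFieldTheory.Balaban1983to89 hiding blockOf
open Literature.MathematicalPhysics.QuantumFieldTheory.Balaban1983to89.B4Sect5Proof (latticeConst latticeConst_nonneg)
open Literature.MathematicalPhysics.QuantumFieldTheory.Balaban1983to89.B5Prop11Plancherel (Tor fine)
open Literature.MathematicalPhysics.QuantumFieldTheory.King1986 (aK aK_pos)
open Literature.MathematicalPhysics.QuantumFieldTheory.King1986.Torus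
open Summit.QuantumFields.BalabanUV.T4Continuum.NE2KingTransplant (IsPseudoMetric UniformCoercive UniformCTBound UniformKernelDecay VolumeSum)

variable {d : ℕ}

/-! ## §1 The dressed tower is Lipschitz in the potential at every level, with locality -/

section Tower

variable {a m2 : ℝ} {L : ℕ} [NeZero L] {M : Fin (d + 1) → ℕ} [∀ μ, NeZero (M μ)]

/-- **`Δ^{(j)}_v` IS LIPSCHITZ IN THE POTENTIAL AT EVERY LEVEL, WITH LOCALITY**: for two potential towers of size `sup|v_N|, sup|v′_N| ≤ w₁ ≤ w̄` with
`sup_{N,x}|v_N(x) − v′_N(x)| ≤ δ_v`:  `UniformKernelDecay (fullPert v − fullPert v′) tdistT (a²·ctCK²·K_W·δ_v) κ′`, i.e.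
`|Δ^{(max j 1)}_v(z,w) − Δ^{(max j 1)}_{v′}(z,w)| ≤ a²ctCK²K_W·δ_v·e^{−2κ′|z−w|}` at every `j` (9b's `effLaplacianPot_lipschitz`, constants uniform along the run
by 9c's `gap_unif`; 9c's `uniformKernelDecay_fullPert` is the case `v′ = 0`). [cite: King1986, (2.13)–(2.14) p.653, (4.34) p.674; Dimock2013, App. D L.30] -/
theorem kingTowerPot_lipschitz (ha : 0 < a) (hm : 0 < m2) (hL : 2 ≤ L) {v v' : ∀ N : ℕ, Tor (fine N (fine L M)) → ℝ} {w₁ δv : ℝ}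
    (hw₁ : w₁ ≤ wbarK (d + 1) a L) (hv : ∀ N x, |v N x| ≤ w₁) (hv' : ∀ N x, |v' N x| ≤ w₁) (hδ : ∀ N x, |v N x - v' N x| ≤ δv) :
    UniformKernelDecay (fullPert a m2 L M v - fullPert a m2 L M v') (tdistT (fine L M))
      (a ^ 2 * ctCK (d + 1) a L ^ 2 * kwSum (d + 1) a L * δv) (kapCT (d + 1) a L) := by
  intro j z w
  have hj : 1 ≤ max j 1 := le_max_right j 1
  set N := L ^ max j 1 with hN
  have hδ0 : 0 ≤ δv := (abs_nonneg _).trans (hδ N (site N (fine L M) z (j0 N)))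
  obtain ⟨hκ0, hκ1, hgap, hC⟩ := gap_unif (d := d) ha hL hj hw₁
  have hκpos : 0 < 4 * kapCT (d + 1) a L := by have := (kapCT_pos_le (d := d + 1) ha hL).1; positivity
  have hak : 0 < aK a L (max j 1) := aK_pos ha (one_lt_cast_of_two_le hL) hj
  have hlo : ∀ x, -w₁ ≤ v N x := fun x => (abs_le.mp (hv N x)).1
  have hlo' : ∀ x, -w₁ ≤ v' N x := fun x => (abs_le.mp (hv' N x)).1
  have h := effLaplacianPot_lipschitz (N := N) (U := fine L M) (m2 := m2) hak.le hm.le hκpos hκ1 hgap hlo hlo' (hδ N) z w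
  rw [Pi.sub_apply, Matrix.sub_apply, fullPert_apply, fullPert_apply, Matrix.sub_apply, Matrix.sub_apply, sub_sub_sub_cancel_right]
  refine h.trans ?_
  have e : 4 * kapCT (d + 1) a L / 2 = 2 * kapCT (d + 1) a L := by ring
  rw [e]
  refine mul_le_mul_of_nonneg_right ?_ (Real.exp_pos _).le
  obtain ⟨-, hk2⟩ := aminL_le_aK ha hL hj
  have hC0 : 0 ≤ ctC (aK a L (max j 1)) w₁ (4 * kapCT (d + 1) a L) (d + 1) := ctC_nonneg (by exact_mod_cast hgap)
  have hK : latticeConst (d + 1) (2 * kapCT (d + 1) a L) = kwSum (d + 1) a L := rfl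
  rw [hK]
  have hKW := (dressedConsts_nonneg (d := d) ha hL).2.1
  gcongr

end Tower

/-! ## §2 The dressed covariances are Lipschitz in the potential at every level, with locality -/

section Cov

open Real

variable (L : ℕ) [NeZero L]

/-- **`C^{(j)}_v = (Δ^{(max j 1)}_v + aL⁻²Q*Q)⁻¹` IS LIPSCHITZ IN THE POTENTIAL AT EVERY LEVEL, WITH LOCALITY** (King's (4.39)–(4.41) between two
dressed towers): for odd `L ≥ 3`, `a, m² > 0` there are `w̄, Λ > 0` such that for every unit torus `Π ℤ∕(LM_μ)` and all potential towers `v, v′` of size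
`≤ w₁ ≤ w̄` with `sup|v − v′| ≤ δ_v ≤ 2w₁`, at every level `j` and all sites:
`|C^{(j)}_v(x, y) − C^{(j)}_{v′}(x, y)| ≤ Λ·δ_v·e^{−(κ′∕2)|x − y|}`.  Base tower `Δ + E(v′)` (H1∕H2∕H4 by 6a from 9c's locality of `E(v′)`), perturbation
`E(v) − E(v′)` (§1), 6a's `inv_sub_inv_perturbed_le`; the gap `ρ + ρ_B + 6c_LVw₁ < γ₀` holds because `ρ + ρ_B ≤ γ₀∕2` and `w̄ ≤ γ₀∕(24c_LV)`.
[cite: King1986, (4.33)–(4.34), (4.39) p.674, (4.40)–(4.41) p.675] -/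
theorem kingCovPot_lipschitz2 (hLodd : Odd L) (hL : 2 ≤ L) {a m2 : ℝ} (ha : 0 < a) (hm : 0 < m2) :
    ∃ wb Λ : ℝ, 0 < wb ∧ 0 < Λ ∧ ∀ (M : Fin (d + 1) → ℕ) [∀ μ, NeZero (M μ)]
      (v v' : ∀ N : ℕ, Tor (fine N (fine L M)) → ℝ) (w₁ δv : ℝ),
      (∀ N x, |v N x| ≤ w₁) → (∀ N x, |v' N x| ≤ w₁) → w₁ ≤ wb → (∀ N x, |v N x - v' N x| ≤ δv) → δv ≤ 2 * w₁ →
      ∀ (j : ℕ) (x y : Tor (fine L M)),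
        |(kingTowerPot a m2 L M v j + kingBlock a L M)⁻¹ x y - (kingTowerPot a m2 L M v' j + kingBlock a L M)⁻¹ x y|
          ≤ Λ * δv * Real.exp (-(kapCT (d + 1) a L / 2 * tdistT (fine L M) x y)) := by
  have _ := hLodd
  obtain ⟨hCK, hKW, hwbar⟩ := dressedConsts_nonneg (d := d) ha hL
  have hγ := gam0L_pos (d := d + 1) ha hL
  have hV := V45_pos (d + 1) ha hL
  obtain ⟨hκ0, -⟩ := kapCT_pos_le (d := d + 1) ha hL
  have hρ := kingRho_add_le (dd := d + 1) ha hL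
  set γ₀ : ℝ := gam0L (d + 1) a L with hγ₀
  set V : ℝ := V45 (d + 1) a L with hVdef
  set cL : ℝ := a ^ 2 * ctCK (d + 1) a L ^ 2 * kwSum (d + 1) a L + 1 with hcLdef
  have hcL : 0 < cL := by positivity
  have hcL' : a ^ 2 * ctCK (d + 1) a L ^ 2 * kwSum (d + 1) a L ≤ cL := by rw [hcLdef]; linarith
  set wb : ℝ := min (wbarK (d + 1) a L) (γ₀ / (24 * cL * V)) with hwbdef
  have hwb : 0 < wb := lt_min hwbar (by positivity)
  refine ⟨wb, cL * (4 / γ₀) ^ 2 * V ^ 2, hwb, by positivity, fun M _ v v' w₁ δv hv hv' hw hδ hδw j x y => ?_⟩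
  have hpd := isPseudoMetric_tdistT (fine L M)
  have hw₁0 : 0 ≤ w₁ := (abs_nonneg _).trans (hv 1 fun _ => 0)
  have hδ0 : 0 ≤ δv := (abs_nonneg _).trans (hδ 1 fun _ => 0)
  have hwbar' : w₁ ≤ wbarK (d + 1) a L := hw.trans (min_le_left _ _)
  -- locality letters: base perturbation `E(v′)` (constant `cL·w₁`) and the difference `E(v) − E(v′)` (constant `cL·δ_v`)
  have hE' : UniformKernelDecay (fullPert a m2 L M v') (tdistT (fine L M)) (cL * w₁) (kapCT (d + 1) a L) :=
    uniformKernelDecay_mono (uniformKernelDecay_fullPert (M := M) ha hm hL hwbar' hv')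
      (by nlinarith [mul_le_mul_of_nonneg_right hcL' hw₁0])
  have hE : UniformKernelDecay (fullPert a m2 L M v - fullPert a m2 L M v') (tdistT (fine L M)) (cL * δv) (kapCT (d + 1) a L) :=
    uniformKernelDecay_mono (kingTowerPot_lipschitz (M := M) ha hm hL hwbar' hv hv' hδ)
      (by nlinarith [mul_le_mul_of_nonneg_right hcL' hδ0])
  -- the base tower `Δ + E(v′)` carries H1, H2, H4 (6a)
  have g1 := uniformCoercive_kingTower (dd := d + 1) (m2 := m2) (M := M) ha hm hL
  have g2 := uniformCTBound_kingTower (dd := d + 1) (m2 := m2) (M := M) ha hm hL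
  have g4 := volumeSum_kingTorus (dd := d + 1) (M := M) ha hL
  have b1 := uniformCoercive_add_of_decay hpd hκ0.le (by positivity) g1 hE' g4
  have b2 := uniformCTBound_add hpd hκ0.le (by positivity) g2 hE' g4
  -- the gap for the perturbation on top of the base: `ρ + ρ_B + 2c_LVw₁ + 2c_LVδ_v < γ₀ − c_LVw₁` ⇐ `6c_LVw₁ ≤ γ₀∕4`
  have hsmall : 6 * (cL * V * w₁) ≤ γ₀ / 4 := by
    have h1 : w₁ ≤ γ₀ / (24 * cL * V) := hw.trans (min_le_right _ _)
    rw [le_div_iff₀ (by positivity)] at h1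
    rw [le_div_iff₀ (by norm_num : (0 : ℝ) < 4)]
    nlinarith
  have hcEV : cL * δv * V ≤ 2 * (cL * V * w₁) := by nlinarith [mul_le_mul_of_nonneg_left hδw (mul_nonneg hcL.le hV.le)]
  have hgap : kingRho (d + 1) a L + cL * w₁ * V + kingRhoB (d + 1) a L + 2 * (cL * δv * V) < γ₀ - cL * w₁ * V := by
    nlinarith [mul_nonneg (mul_nonneg hcL.le hV.le) hw₁0]
  -- 6a's background-Lipschitz lemma between the base and the base + perturbation
  have hkey := inv_sub_inv_perturbed_le (D := kingTower a m2 L M + fullPert a m2 L M v') (B := kingBlock a L M)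
    (E := fullPert a m2 L M v - fullPert a m2 L M v') hpd hκ0.le (by positivity) hgap b1 b2 g4 hE j x y
  -- identify the two towers: `Δ + E(v′) = Δ_{v′}`, `Δ + E(v′) + (E(v) − E(v′)) = Δ_v`
  have hT' : (kingTower a m2 L M + fullPert a m2 L M v') j = kingTowerPot a m2 L M v' j := by
    rw [kingTower_add_fullPert]
  have hT : (kingTower a m2 L M + fullPert a m2 L M v') j + (fullPert a m2 L M v - fullPert a m2 L M v') j = kingTowerPot a m2 L M v j := by
    rw [← kingTower_add_fullPert v]
    simp only [Pi.add_apply, Pi.sub_apply]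
    abel
  rw [hT, hT'] at hkey
  rw [abs_sub_comm]
  refine hkey.trans ?_
  -- the margin is at least `γ₀∕4`
  have hmar : γ₀ / 4 ≤ γ₀ - cL * w₁ * V - cL * δv * V - (kingRho (d + 1) a L + cL * w₁ * V + cL * δv * V + kingRhoB (d + 1) a L) := by
    nlinarith [mul_nonneg (mul_nonneg hcL.le hV.le) hw₁0]
  have hinvle : (γ₀ - cL * w₁ * V - cL * δv * V - (kingRho (d + 1) a L + cL * w₁ * V + cL * δv * V + kingRhoB (d + 1) a L))⁻¹ ≤ 4 / γ₀ := by
    have h2 := inv_anti₀ (by positivity : 0 < γ₀ / 4) hmar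
    rwa [inv_div] at h2
  have hinv0 : 0 ≤ (γ₀ - cL * w₁ * V - cL * δv * V - (kingRho (d + 1) a L + cL * w₁ * V + cL * δv * V + kingRhoB (d + 1) a L))⁻¹ :=
    inv_nonneg.mpr (by linarith)
  have hsq := pow_le_pow_left₀ hinv0 hinvle 2
  have hE0 : 0 ≤ Real.exp (-(kapCT (d + 1) a L / 2 * tdistT (fine L M) x y)) := (Real.exp_pos _).le
  calc cL * δv * ((γ₀ - cL * w₁ * V - cL * δv * V
            - (kingRho (d + 1) a L + cL * w₁ * V + cL * δv * V + kingRhoB (d + 1) a L))⁻¹) ^ 2 * V ^ 2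
          * Real.exp (-(kapCT (d + 1) a L / 2 * tdistT (fine L M) x y))
      ≤ cL * δv * (4 / γ₀) ^ 2 * V ^ 2 * Real.exp (-(kapCT (d + 1) a L / 2 * tdistT (fine L M) x y)) := by
        gcongr
    _ = cL * (4 / γ₀) ^ 2 * V ^ 2 * δv * Real.exp (-(kapCT (d + 1) a L / 2 * tdistT (fine L M) x y)) := by ring

end Cov

/-! ## §3 The bounds pass to ANY entrywise `k → ∞` limits -/

section Limits

variable {a m2 : ℝ} {L : ℕ} [NeZero L] {M : Fin (d + 1) → ℕ} [∀ μ, NeZero (M μ)]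

/-- **THE CONTINUUM DRESSED EFFECTIVE LAPLACIAN IS LIPSCHITZ IN THE POTENTIAL, WITH LOCALITY**: if `Δ^{(j)}_v(z,w) → D(z,w)` and
`Δ^{(j)}_{v′}(z,w) → D′(z,w)` entrywise as `j → ∞` (e.g. part 10e's `king_continuumLimit_W` limits), for towers of size `≤ w₁ ≤ w̄` with
`sup|v − v′| ≤ δ_v`, then `|D(z,w) − D′(z,w)| ≤ a²ctCK²K_W·δ_v·e^{−2κ′|z−w|}` (§1 + `le_of_tendsto`). [cite: King1986, (4.34) p.674, pp.675–676 (§4)] -/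
theorem dressedTowerLim_lipschitz (ha : 0 < a) (hm : 0 < m2) (hL : 2 ≤ L) {v v' : ∀ N : ℕ, Tor (fine N (fine L M)) → ℝ} {w₁ δv : ℝ}
    (hw₁ : w₁ ≤ wbarK (d + 1) a L) (hv : ∀ N x, |v N x| ≤ w₁) (hv' : ∀ N x, |v' N x| ≤ w₁) (hδ : ∀ N x, |v N x - v' N x| ≤ δv)
    {D D' : Matrix (Tor (fine L M)) (Tor (fine L M)) ℝ}
    (hD : ∀ z w, Tendsto (fun j => kingTowerPot a m2 L M v j z w) atTop (𝓝 (D z w)))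
    (hD' : ∀ z w, Tendsto (fun j => kingTowerPot a m2 L M v' j z w) atTop (𝓝 (D' z w))) (z w : Tor (fine L M)) :
    |D z w - D' z w| ≤ a ^ 2 * ctCK (d + 1) a L ^ 2 * kwSum (d + 1) a L * δv * Real.exp (-(2 * kapCT (d + 1) a L * tdistT (fine L M) z w)) := by
  have hlip := kingTowerPot_lipschitz (M := M) ha hm hL hw₁ hv hv' hδ
  have hlim : Tendsto (fun j => kingTowerPot a m2 L M v j z w - kingTowerPot a m2 L M v' j z w) atTop (𝓝 (D z w - D' z w)) :=
    (hD z w).sub (hD' z w)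
  refine le_of_tendsto hlim.abs (Filter.Eventually.of_forall fun j => ?_)
  have h := hlip j z w
  rw [Pi.sub_apply, Matrix.sub_apply] at h
  have e : (fullPert a m2 L M v j - fullPert a m2 L M v' j) z w
      = kingTowerPot a m2 L M v j z w - kingTowerPot a m2 L M v' j z w := by
    rw [← kingTower_add_fullPert v, ← kingTower_add_fullPert v']
    simp only [Pi.add_apply, Matrix.add_apply, Matrix.sub_apply]
    ring
  rw [Matrix.sub_apply] at e
  rw [← e]
  exact h

variable (L)

/-- **THE CONTINUUM DRESSED COVARIANCE IS LIPSCHITZ IN THE POTENTIAL, WITH LOCALITY**: with the constants `w̄, Λ` of `kingCovPot_lipschitz2`, if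
`C^{(j)}_v(x,y) → C(x,y)` and `C^{(j)}_{v′}(x,y) → C′(x,y)` entrywise (e.g. part 10e's `king_continuumLimit_W` limits; the dressed covariance is
written `kingCovE … (fullPert v) = (Δ_v + aL⁻²Q*Q)⁻¹`, 9c `kingCovE_fullPert`), then `|C(x,y) − C′(x,y)| ≤ Λ·δ_v·e^{−(κ′∕2)|x−y|}`.
[cite: King1986, Lemma 4.5 (4.38), (4.39) p.674, (4.40)–(4.41) p.675, pp.675–676 (§4)] -/
theorem dressedCovLim_lipschitz (hLodd : Odd L) (hL : 2 ≤ L) (ha : 0 < a) (hm : 0 < m2) :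
    ∃ wb Λ : ℝ, 0 < wb ∧ 0 < Λ ∧ ∀ (M : Fin (d + 1) → ℕ) [∀ μ, NeZero (M μ)]
      (v v' : ∀ N : ℕ, Tor (fine N (fine L M)) → ℝ) (w₁ δv : ℝ),
      (∀ N x, |v N x| ≤ w₁) → (∀ N x, |v' N x| ≤ w₁) → w₁ ≤ wb → (∀ N x, |v N x - v' N x| ≤ δv) → δv ≤ 2 * w₁ →
      ∀ (C C' : Matrix (Tor (fine L M)) (Tor (fine L M)) ℝ),
      (∀ x y, Tendsto (fun j => kingCovE a m2 L M (fullPert a m2 L M v) j x y) atTop (𝓝 (C x y))) →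
      (∀ x y, Tendsto (fun j => kingCovE a m2 L M (fullPert a m2 L M v') j x y) atTop (𝓝 (C' x y))) →
      ∀ x y, |C x y - C' x y| ≤ Λ * δv * Real.exp (-(kapCT (d + 1) a L / 2 * tdistT (fine L M) x y)) := by
  obtain ⟨wb, Λ, hwb, hΛ, H⟩ := kingCovPot_lipschitz2 (d := d) L hLodd hL ha hm
  refine ⟨wb, Λ, hwb, hΛ, fun M _ v v' w₁ δv hv hv' hw hδ hδw C C' hC hC' x y => ?_⟩
  have hlim : Tendsto (fun j => kingCovE a m2 L M (fullPert a m2 L M v) j x y - kingCovE a m2 L M (fullPert a m2 L M v') j x y)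
      atTop (𝓝 (C x y - C' x y)) := (hC x y).sub (hC' x y)
  refine le_of_tendsto hlim.abs (Filter.Eventually.of_forall fun j => ?_)
  have h := H M v v' w₁ δv hv hv' hw hδ hδw j x y
  rwa [← kingCovE_fullPert v j, ← kingCovE_fullPert v' j] at h

end Limits

end Summit.QuantumFields.YangMills.BalabanUVNodes.N15.KingModel

end
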